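import Summits.RiemannHypothesis.RiemannHypothesis.Theorems.IntegerScrewCensusFastCheck

/-!
# Route `IntegerScrew` — fast kernel arithmetic for manifest-certificate checks (5b): the plain packing pass, revised

`IntegerScrewCensusFastCheck.packP` packs the plain digits by a TAIL recursion whose accumulator arguments carry the
digits `digP X = (X + 2^53) − 2^200`; unfolding such a recursion symbolically makes the kernel normalise `Nat.sub _ 2^200`
in unary («excessive memory», the known pitfall of the offset representation), so no equation of `packP` can be proved.
This file replaces it by a STRUCTURAL right fold `packPB` that carries the power `W^{length}` (computed values only in
result positions, like `packW`), and re-assembles the node packer `packNodeB`, `packAllB` and the checker `fastCheckB`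
from the unchanged pieces of `IntegerScrewCensusFastCheck` (`packW`, `pairAbs`, `diagLoN`, `lowTri`, `colSums`, `rowsOK`,
`fastLight`).  The unfolding equations of the recursions used by the soundness proof are stated here and proved by `rfl`.
Pure arithmetic; RH-free and ζ-free; nothing here bears on the truth of RH.
-/

set_option linter.dupNamespace false
set_option autoImplicit false

namespace Summit.RiemannHypothesis.RiemannHypothesis.Theorems.IntegerScrew.Manifest.Fast

open Literature.Analysis.ValidatedNumerics Literature.Analysis.ValidatedNumerics.Numerics
open Literature.Analysis.ValidatedNumerics.KroneckerDot

/-- Plain pass as a RIGHT fold carrying the power: `(Σ dPc_k W^{L−1−k}, Σ dPs_k W^{L−1−k}, Σ dPc, Σ dPs, W^L)` for a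
row of length `L`. -/
def packPB : List (ℕ × ℕ) → ℕ × ℕ × ℕ × ℕ × ℕ
  | p :: ps =>
    let r := packPB ps
    let dc := digP p.1
    let ds := digP p.2
    (Nat.add (Nat.mul dc r.2.2.2.2) r.1, Nat.add (Nat.mul ds r.2.2.2.2) r.2.1, Nat.add dc r.2.2.1, Nat.add ds r.2.2.2.1,
      Nat.mul WS r.2.2.2.2)
  | [] => (0, 0, 0, 0, 1)

/-- Pack one node (as `packNode`, with `packPB`). -/
def packNodeB (E1 : ℕ) (oms : List ℕ) (dr : ℕ × List (ℕ × ℕ)) (u1 : ℕ × ℕ) : NodeP :=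
  let w := packW oms dr.2
  let p := packPB dr.2
  let na := Nat.add (Nat.mul D1 (Nat.add w.2.2.1 w.2.2.2)) (Nat.mul SCL w.2.2.1)
  let nb := Nat.add (Nat.mul D0 (Nat.add p.2.2.1 p.2.2.2.1)) (Nat.mul SCL w.2.2.1)
  let f4 := Nat.mul (Nat.mul 4 dr.1) E1
  let f45 := Nat.mul (Nat.add (Nat.mul 4 dr.1) 5) E1
  ⟨dr.1, w.1, w.2.1, p.1, p.2.1, w.2.2.1, w.2.2.2, p.2.2.1, p.2.2.2.1, u1.1, u1.2,
    Nat.sub (Nat.add (Nat.add u1.1 na) ZB) f4, Nat.sub (Nat.add (Nat.add u1.1 nb) ZB) f45,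
    Nat.add (Nat.add u1.2 na) f4, Nat.add (Nat.add u1.2 nb) f45⟩

/-- The packed nodes `a = 2, 3, …` (as `packAll`, with `packNodeB`). -/
def packAllB (E1 : ℕ) (oms : List ℕ) : List (ℕ × List (ℕ × ℕ)) → List (List (ℕ × ℕ)) → List NodeP
  | dr :: drs, urow :: urows => packNodeB E1 oms dr (urow.getD 1 (0, 0)) :: packAllB E1 oms drs urows
  | _, _ => []

/-- **THE CHECKER** (as `fastCheck`, with `packAllB`). -/
def fastCheckB (n : ℕ) (logs : List FI) (utab : List (List (ℕ × ℕ))) (js oms : List ℕ) (WJ CL CH : ℕ) : Bool :=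
  let K := js.length
  let R := rowsD tcLitN logs 500 js n
  let urows := (utab.drop 2).take n
  let E1 := errUnit (maxLogWidth logs (n + 1)) js oms
  let SO := sumN oms
  let Ps := packAllB E1 oms (R.1.drop 2) urows
  let POS := Nat.add (Nat.add (Nat.mul (2 ^ 104) (Nat.add SO WJ)) (Nat.mul (Nat.mul 2 K) (Nat.mul D0 D1)))
    (Nat.mul (Nat.mul (2 ^ 53) K) D0)
  let G1 := Nat.sub (Nat.add CL (Nat.mul 2 ZB)) POS
  let G2 := Nat.sub (Nat.add CH (Nat.mul 2 ZB)) POS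
  let WJS2 := Nat.add (Nat.mul (2 ^ 104) (Nat.add (Nat.mul 2 SO) WJ)) (Nat.mul (Nat.mul (2 ^ 53) K) D0)
  let tri := lowTri (Nat.mul WB (K - 1)) G1 G2 Ps Ps urows
  R.2 && rowsOK CL WJS2 E1 Ps tri (colSums tri)

/-! ### Unfolding equations (by `rfl`; the digits are never normalised) -/

/-- `packPB []`. -/
theorem packPB_nil : packPB [] = (0, 0, 0, 0, 1) := rfl

/-- `packPB (p :: ps)`. -/
theorem packPB_cons (p : ℕ × ℕ) (ps : List (ℕ × ℕ)) :
    packPB (p :: ps) =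
      (digP p.1 * (packPB ps).2.2.2.2 + (packPB ps).1, digP p.2 * (packPB ps).2.2.2.2 + (packPB ps).2.1,
        digP p.1 + (packPB ps).2.2.1, digP p.2 + (packPB ps).2.2.2.1, WS * (packPB ps).2.2.2.2) := rfl

/-- `packW [] row`. -/
theorem packW_nil (row : List (ℕ × ℕ)) : packW [] row = (0, 0, 0, 0) := by cases row <;> rfl

/-- `packW (o :: os) []`. -/
theorem packW_cons_nil (o : ℕ) (os : List ℕ) : packW (o :: os) [] = (0, 0, 0, 0) := rfl

/-- `packW (o :: os) (p :: ps)`. -/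
theorem packW_cons (o : ℕ) (os : List ℕ) (p : ℕ × ℕ) (ps : List (ℕ × ℕ)) :
    packW (o :: os) (p :: ps) =
      (digW o p.1 + WS * (packW os ps).1, digW o p.2 + WS * (packW os ps).2.1,
        digW o p.1 + (packW os ps).2.2.1, digW o p.2 + (packW os ps).2.2.2) := rfl

/-- `packAllB` on cons/cons. -/
theorem packAllB_cons (E1 : ℕ) (oms : List ℕ) (dr : ℕ × List (ℕ × ℕ)) (drs : List (ℕ × List (ℕ × ℕ)))
    (urow : List (ℕ × ℕ)) (urows : List (List (ℕ × ℕ))) :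
    packAllB E1 oms (dr :: drs) (urow :: urows) = packNodeB E1 oms dr (urow.getD 1 (0, 0)) :: packAllB E1 oms drs urows :=
  rfl

/-- `lowRow` on cons/cons. -/
theorem lowRow_cons (sh gx gy : ℕ) (Pa Pb : NodeP) (Ps : List NodeP) (uab : ℕ × ℕ) (us : List (ℕ × ℕ)) :
    lowRow sh gx gy Pa (Pb :: Ps) (uab :: us) = pairAbs sh gx gy Pa Pb uab :: lowRow sh gx gy Pa Ps us := rfl

/-- `lowTri` on cons/cons. -/
theorem lowTri_cons (sh G1 G2 : ℕ) (Ps : List NodeP) (Pa : NodeP) (rest : List NodeP) (urow : List (ℕ × ℕ))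
    (urows : List (List (ℕ × ℕ))) :
    lowTri sh G1 G2 Ps (Pa :: rest) (urow :: urows) =
      lowRow sh (G1 + Pa.xa) (G2 + Pa.ya) Pa Ps (urow.drop 2) :: lowTri sh G1 G2 Ps rest urows := rfl

/-- `unpackNN` successor step. -/
theorem unpackNN_succ (B W m k : ℕ) :
    unpackNN B W m (k + 1) = (SH * (m % B), SH * (m % B + m / B % W)) :: unpackNN B W (m / B / W) k := rfl

/-- The fields of `packNodeB`. -/
theorem packNodeB_eq (E1 : ℕ) (oms : List ℕ) (dr : ℕ × List (ℕ × ℕ)) (u1 : ℕ × ℕ) :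
    packNodeB E1 oms dr u1 =
      ⟨dr.1, (packW oms dr.2).1, (packW oms dr.2).2.1, (packPB dr.2).1, (packPB dr.2).2.1, (packW oms dr.2).2.2.1,
        (packW oms dr.2).2.2.2, (packPB dr.2).2.2.1, (packPB dr.2).2.2.2.1, u1.1, u1.2,
        u1.1 + (D1 * ((packW oms dr.2).2.2.1 + (packW oms dr.2).2.2.2) + SCL * (packW oms dr.2).2.2.1) + ZB -
          4 * dr.1 * E1,
        u1.1 + (D0 * ((packPB dr.2).2.2.1 + (packPB dr.2).2.2.2.1) + SCL * (packW oms dr.2).2.2.1) + ZB -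
          (4 * dr.1 + 5) * E1,
        u1.2 + (D1 * ((packW oms dr.2).2.2.1 + (packW oms dr.2).2.2.2) + SCL * (packW oms dr.2).2.2.1) + 4 * dr.1 * E1,
        u1.2 + (D0 * ((packPB dr.2).2.2.1 + (packPB dr.2).2.2.2.1) + SCL * (packW oms dr.2).2.2.1) +
          (4 * dr.1 + 5) * E1⟩ := rfl

/-- `pairAbs` unfolded to notation. -/
theorem pairAbs_eq (sh gx gy : ℕ) (Pa Pb : NodeP) (uab : ℕ × ℕ) :
    pairAbs sh gx gy Pa Pb uab =
      max (OZ + 4 * ZB - (gx + Pb.xb - (uab.2 + (kdotS sh Pa.uc Pb.vc + kdotS sh Pa.us Pb.vs))))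
        (gy + Pb.yb - (uab.1 + (kdotS sh Pa.uc Pb.vc + kdotS sh Pa.us Pb.vs)) - (OZ + 2 * ZB)) := rfl

/-- `diagLoN` unfolded to notation. -/
theorem diagLoN_eq (CL WJS2 E1 : ℕ) (Pa : NodeP) :
    diagLoN CL WJS2 E1 Pa = 2 * CL + 2 * Pa.ulo + 2 ^ 53 * Pa.lwc + 2 * E1 + ZB - (WJS2 + 4 * Pa.d * E1) := rfl

end Summit.RiemannHypothesis.RiemannHypothesis.Theorems.IntegerScrew.Manifest.Fast
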